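import Mathlib

/-!
# PneNP / ConvexRankGates — `ConvexGateBlind`: trace bounds and Farkas certificates for CONV gates

Helpers (`--supports stmt-PneNP-10680`). A CONV gate `x ↦ [∃ Y ⪰ 0, tr(Aᵢ Y) ≤ rᵢ(x) ∀ i]` may
reject an input by WEAK infeasibility (no dual certificate; refuter's 2 × 2 gadget on the item).
On a finite input type this is repaired at no cost:
* `conv_feasible_iff_traceBounded`: WLOG the PSD variable has bounded trace `tr Y ≤ R` (`R > 0`
  = one plus the sum of the traces of chosen witnesses over the finitely many accepted inputs);
* `certificate_of_infeasible_traceBounded` (**Farkas lemma for trace-bounded semidefinite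
  programmes**): if `{Y ⪰ 0, tr Y ≤ R, tr(Aᵢ Y) ≤ rᵢ}` is infeasible (`R > 0`) then there are
  multipliers `y ≥ 0`, `λ ≥ 0` with `∑ yᵢ tr(Aᵢ Y) + λ tr Y ≥ 0` for every `Y ⪰ 0` and
  `∑ yᵢ rᵢ + λ R < 0` — proof: strict separation of `0` from the closed convex set
  `Φ(S) + ℝ^p_{≥0}`, `S = {Y ⪰ 0, tr Y ≤ R}` compact, then absorb the margin into the trace multiplier;
* `infeasible_of_certificate`: weak duality (the converse).
So every rejection of a (trace-normalised) CONV gate is witnessed by a non-negative combination of its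
rows that is non-negative on the whole PSD cone yet negative at the input's right-hand side — the
"rejecting dual certificate = non-negative weighting" used by the route's intended method.
-/

namespace Summit.PneNP.PneNP.Theorems

open Matrix Finset
open scoped Pointwise

/-! ### Entry bounds and compactness of `{Y ⪰ 0, tr Y ≤ R}` -/

/-- For a real PSD matrix, `|Y i j| ≤ tr Y`. [folklore] -/
theorem abs_entry_le_trace_of_posSemidef {q : ℕ} {Y : Matrix (Fin q) (Fin q) ℝ}
    (hY : Y.PosSemidef) (i j : Fin q) : |Y i j| ≤ Y.trace := by
  have hdiag : ∀ k, 0 ≤ Y k k := fun k => hY.diag_nonneg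
  have hsymm : Y j i = Y i j := by
    have h := hY.isHermitian
    have := congrFun (congrFun h i) j
    simpa [Matrix.conjTranspose_apply] using this
  -- quadratic form at `e_i + e_j` and `e_i - e_j`
  have hq : ∀ v : Fin q → ℝ, 0 ≤ v ⬝ᵥ (Y *ᵥ v) := fun v => by
    simpa using hY.dotProduct_mulVec_nonneg v
  have key : ∀ (ε : ℝ), ε = 1 ∨ ε = -1 →
      (Pi.single i (1 : ℝ) + ε • Pi.single j (1 : ℝ)) ⬝ᵥ
        (Y *ᵥ (Pi.single i (1 : ℝ) + ε • Pi.single j (1 : ℝ))) =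
        Y i i + ε * Y i j + ε * Y j i + ε * ε * Y j j := by
    intro ε _
    simp only [Matrix.mulVec_add, Matrix.mulVec_smul, dotProduct_add, add_dotProduct,
      smul_dotProduct, dotProduct_smul, Matrix.mulVec_single,
      single_dotProduct, one_mul, smul_eq_mul, MulOpposite.op_one, one_smul]
    simp only [Matrix.col_apply] 
    ring
  by_cases hij : i = j
  · subst hij
    rw [abs_of_nonneg (hdiag i)]
    exact Finset.single_le_sum (fun k _ => hdiag k) (Finset.mem_univ i)
  · have h1 := hq (Pi.single i 1 + (1 : ℝ) • Pi.single j 1)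
    have h2 := hq (Pi.single i 1 + (-1 : ℝ) • Pi.single j 1)
    rw [key 1 (Or.inl rfl)] at h1
    rw [key (-1) (Or.inr rfl)] at h2
    rw [hsymm] at h1 h2
    have hsum : Y i i + Y j j ≤ Y.trace := by
      calc Y i i + Y j j = ∑ k ∈ ({i, j} : Finset (Fin q)), Y k k :=
            (Finset.sum_pair (f := fun k => Y k k) hij).symm
        _ ≤ ∑ k, Y k k :=
          Finset.sum_le_sum_of_subset_of_nonneg (Finset.subset_univ _) (fun k _ _ => hdiag k)
        _ = Y.trace := rfl
    rw [abs_le]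
    constructor <;> nlinarith

/-- The set `{Y ⪰ 0, tr Y ≤ R}` of real `q × q` matrices is compact. [folklore] -/
theorem isCompact_posSemidef_trace_le (q : ℕ) (R : ℝ) :
    IsCompact {Y : Matrix (Fin q) (Fin q) ℝ | Y.PosSemidef ∧ Y.trace ≤ R} := by
  -- closed
  have hclosed : IsClosed {Y : Matrix (Fin q) (Fin q) ℝ | Y.PosSemidef ∧ Y.trace ≤ R} := by
    have hrepr : {Y : Matrix (Fin q) (Fin q) ℝ | Y.PosSemidef ∧ Y.trace ≤ R} =
        {Y | Yᵀ = Y} ∩ ((⋂ v : Fin q → ℝ, {Y | 0 ≤ v ⬝ᵥ (Y *ᵥ v)}) ∩ {Y | Y.trace ≤ R}) := by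
      ext Y
      simp only [Set.mem_setOf_eq, Set.mem_inter_iff, Set.mem_iInter]
      rw [Matrix.posSemidef_iff_dotProduct_mulVec]
      simp only [Matrix.IsHermitian, Matrix.conjTranspose_eq_transpose_of_trivial, star_trivial]
      tauto
    rw [hrepr]
    refine IsClosed.inter (isClosed_eq continuous_id.matrix_transpose continuous_id)
      (IsClosed.inter (isClosed_iInter fun v => ?_) ?_)
    · exact isClosed_le continuous_const
        (continuous_const.dotProduct (continuous_id.matrix_mulVec continuous_const))
    · exact isClosed_le continuous_id.matrix_trace continuous_const
  -- inside a compact box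
  have hbox : IsCompact (Set.pi Set.univ fun _ : Fin q => Set.pi Set.univ fun _ : Fin q => Set.Icc (-R) R :
      Set (Matrix (Fin q) (Fin q) ℝ)) :=
    isCompact_univ_pi fun _ => isCompact_univ_pi fun _ => isCompact_Icc
  refine hbox.of_isClosed_subset hclosed ?_
  rintro Y ⟨hY, htr⟩
  simp only [Set.mem_pi, Set.mem_univ, true_implies, Set.mem_Icc]
  intro i j
  have h := (abs_entry_le_trace_of_posSemidef hY i j).trans htr
  exact abs_le.1 h

/-! ### Farkas certificates -/

/-- **Weak duality.** A non-negative combination of the rows and the trace bound that is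
non-negative on the PSD cone but negative at the right-hand side refutes feasibility. [folklore] -/
theorem infeasible_of_certificate {p q : ℕ} (A : Fin p → Matrix (Fin q) (Fin q) ℝ) (r : Fin p → ℝ)
    (R : ℝ) (y : Fin p → ℝ) (lam : ℝ) (hy : ∀ i, 0 ≤ y i) (hlam : 0 ≤ lam)
    (hpsd : ∀ Y : Matrix (Fin q) (Fin q) ℝ, Y.PosSemidef →
      0 ≤ ∑ i, y i * (A i * Y).trace + lam * Y.trace)
    (hneg : ∑ i, y i * r i + lam * R < 0) :
    ¬ ∃ Y : Matrix (Fin q) (Fin q) ℝ, Y.PosSemidef ∧ Y.trace ≤ R ∧ ∀ i, (A i * Y).trace ≤ r i := by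
  rintro ⟨Y, hY, htr, hrows⟩
  have h1 := hpsd Y hY
  have h2 : ∑ i, y i * (A i * Y).trace ≤ ∑ i, y i * r i :=
    Finset.sum_le_sum fun i _ => mul_le_mul_of_nonneg_left (hrows i) (hy i)
  have h3 : lam * Y.trace ≤ lam * R := mul_le_mul_of_nonneg_left htr hlam
  linarith

/-- **Farkas lemma for trace-bounded semidefinite programmes.** If `{Y ⪰ 0, tr Y ≤ R, tr(Aᵢ Y) ≤ rᵢ ∀ i}`
(`R > 0`) is infeasible, then some `y ≥ 0`, `λ ≥ 0` satisfy `∑ yᵢ tr(Aᵢ Y) + λ tr Y ≥ 0` for all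
`Y ⪰ 0` and `∑ yᵢ rᵢ + λ R < 0`. (Strict separation of `0` from the closed convex set
`{v | ∃ Y ⪰ 0, tr Y ≤ R, tr(Aᵢ Y) - rᵢ ≤ vᵢ}` — closed because `{Y ⪰ 0, tr Y ≤ R}` is compact —
then the separation margin is absorbed into the trace multiplier and homogeneity of the PSD cone
finishes.) [folklore] -/
theorem certificate_of_infeasible_traceBounded {p q : ℕ} (A : Fin p → Matrix (Fin q) (Fin q) ℝ)
    (r : Fin p → ℝ) {R : ℝ} (hR : 0 < R)
    (hinf : ¬ ∃ Y : Matrix (Fin q) (Fin q) ℝ, Y.PosSemidef ∧ Y.trace ≤ R ∧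
      ∀ i, (A i * Y).trace ≤ r i) :
    ∃ (y : Fin p → ℝ) (lam : ℝ), (∀ i, 0 ≤ y i) ∧ 0 ≤ lam ∧
      (∀ Y : Matrix (Fin q) (Fin q) ℝ, Y.PosSemidef →
        0 ≤ ∑ i, y i * (A i * Y).trace + lam * Y.trace) ∧
      ∑ i, y i * r i + lam * R < 0 := by
  classical
  -- the compact base and the affine map
  set S : Set (Matrix (Fin q) (Fin q) ℝ) := {Y | Y.PosSemidef ∧ Y.trace ≤ R} with hS
  set Φ : Matrix (Fin q) (Fin q) ℝ → (Fin p → ℝ) := fun Y i => (A i * Y).trace - r i with hΦ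
  have hΦc : Continuous Φ :=
    continuous_pi fun i => ((continuous_const.matrix_mul continuous_id).matrix_trace).sub
      continuous_const
  set C : Set (Fin p → ℝ) := Φ '' S + Set.Ici (0 : Fin p → ℝ) with hC
  -- `C` is closed (compact + closed) and convex, and misses `0`
  have hCclosed : IsClosed C :=
    (isClosed_Ici).add_left_of_isCompact ((isCompact_posSemidef_trace_le q R).image hΦc)
  have hmemC : ∀ v, v ∈ C ↔ ∃ Y, Y.PosSemidef ∧ Y.trace ≤ R ∧ ∀ i, (A i * Y).trace - r i ≤ v i := by
    intro v
    simp only [hC, Set.mem_add, Set.mem_image, Set.mem_Ici, hS, Set.mem_setOf_eq]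
    constructor
    · rintro ⟨_, ⟨Y, ⟨hY, htr⟩, rfl⟩, u, hu, rfl⟩
      exact ⟨Y, hY, htr, fun i => by simpa [hΦ] using hu i⟩
    · rintro ⟨Y, hY, htr, hle⟩
      refine ⟨Φ Y, ⟨Y, ⟨hY, htr⟩, rfl⟩, v - Φ Y, fun i => ?_, add_sub_cancel _ _⟩
      simpa [hΦ] using hle i
  have hCconv : Convex ℝ C := by
    intro v₁ hv₁ v₂ hv₂ a c ha hc hac
    rw [hmemC] at hv₁ hv₂ ⊢
    obtain ⟨Y₁, hY₁, htr₁, h₁⟩ := hv₁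
    obtain ⟨Y₂, hY₂, htr₂, h₂⟩ := hv₂
    refine ⟨a • Y₁ + c • Y₂, (hY₁.smul ha).add (hY₂.smul hc), ?_, fun i => ?_⟩
    · rw [Matrix.trace_add, Matrix.trace_smul, Matrix.trace_smul, smul_eq_mul, smul_eq_mul]
      nlinarith
    · rw [Matrix.mul_add, Matrix.mul_smul, Matrix.mul_smul, Matrix.trace_add, Matrix.trace_smul,
        Matrix.trace_smul, smul_eq_mul, smul_eq_mul]
      simp only [Pi.add_apply, Pi.smul_apply, smul_eq_mul]
      have e₁ := mul_le_mul_of_nonneg_left (h₁ i) ha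
      have e₂ := mul_le_mul_of_nonneg_left (h₂ i) hc
      have hr : a * r i + c * r i = r i := by rw [← add_mul, hac, one_mul]
      rw [mul_sub] at e₁ e₂
      linarith
  have h0 : (0 : Fin p → ℝ) ∉ C := by
    rw [hmemC]
    rintro ⟨Y, hY, htr, hle⟩
    exact hinf ⟨Y, hY, htr, fun i => by simpa using hle i⟩
  -- strict separation
  obtain ⟨f, u, hfu, hfC⟩ := geometric_hahn_banach_point_closed hCconv hCclosed h0
  rw [map_zero] at hfu
  -- coordinates of `f`
  set y : Fin p → ℝ := fun i => f (fun j => if i = j then 1 else 0) with hy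
  have hf : ∀ v : Fin p → ℝ, f v = ∑ i, v i * y i := by
    intro v
    rw [show f v = f.toLinearMap v from rfl, LinearMap.pi_apply_eq_sum_univ]
    rfl
  -- a base point of `C`
  have hbase : ∀ Y, Y.PosSemidef → Y.trace ≤ R → Φ Y ∈ C := fun Y hY htr =>
    (hmemC _).2 ⟨Y, hY, htr, fun i => le_refl _⟩
  have hup : ∀ v ∈ C, ∀ w : Fin p → ℝ, (∀ i, 0 ≤ w i) → v + w ∈ C := by
    intro v hv w hw
    rw [hmemC] at hv ⊢
    obtain ⟨Y, hY, htr, hle⟩ := hv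
    exact ⟨Y, hY, htr, fun i => by have := hle i; have := hw i; simp only [Pi.add_apply]; linarith⟩
  -- (i) the coordinates are non-negative
  have hy0 : ∀ i, 0 ≤ y i := by
    intro i
    by_contra hneg
    push Not at hneg
    have hc₀ : Φ 0 ∈ C := hbase 0 Matrix.PosSemidef.zero (by simp; exact hR.le)
    set t : ℝ := (f (Φ 0) - u) / (-y i) + 1 with ht
    have htpos : 0 ≤ t := by
      have : 0 ≤ (f (Φ 0) - u) / (-y i) := div_nonneg (by linarith [hfC _ hc₀]) (by linarith)
      linarith
    have hmem : Φ 0 + t • (fun j => if i = j then (1 : ℝ) else 0) ∈ C :=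
      hup _ hc₀ _ fun j => by
        simp only [Pi.smul_apply, smul_eq_mul]
        split_ifs <;> nlinarith
    have hval := hfC _ hmem
    rw [map_add, map_smul, smul_eq_mul] at hval
    have hyne : y i ≠ 0 := ne_of_lt hneg
    have : t * y i = -(f (Φ 0) - u) + y i := by
      rw [ht]
      field_simp
    simp only [hy] at this hval
    linarith
  -- (ii) the separation inequality on the base
  have hsep : ∀ Y, Y.PosSemidef → Y.trace ≤ R → u < ∑ i, y i * ((A i * Y).trace - r i) := by
    intro Y hY htr
    have := hfC _ (hbase Y hY htr)
    rw [hf] at this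
    simpa [hΦ, mul_comm] using this
  -- (iii) at `Y = 0`
  have hat0 : ∑ i, y i * r i < -u := by
    have := hsep 0 Matrix.PosSemidef.zero (by simp; exact hR.le)
    simp only [Matrix.mul_zero, Matrix.trace_zero, zero_sub, mul_neg, Finset.sum_neg_distrib] at this
    linarith
  -- (iv) absorb the margin into the trace multiplier
  refine ⟨y, (-(u + ∑ i, y i * r i)) / R, hy0, div_nonneg (by linarith) hR.le, fun Y hY => ?_, ?_⟩
  · by_cases hY0 : Y = 0
    · subst hY0
      simp
    · have htrpos : 0 < Y.trace := by
        rcases (hY.trace_nonneg).lt_or_eq with h | h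
        · exact h
        · exact absurd (hY.trace_eq_zero_iff.1 h.symm) hY0
      -- rescale to trace `R`
      set Y' := (R / Y.trace) • Y with hY'
      have hcpos : 0 < R / Y.trace := div_pos hR htrpos
      have hY'psd : Y'.PosSemidef := hY.smul hcpos.le
      have hY'tr : Y'.trace = R := by
        rw [hY', Matrix.trace_smul, smul_eq_mul, div_mul_cancel₀ _ htrpos.ne']
      have h := hsep Y' hY'psd hY'tr.le
      have hrows : ∀ i, (A i * Y').trace = (R / Y.trace) * (A i * Y).trace := by
        intro i
        rw [hY', Matrix.mul_smul, Matrix.trace_smul, smul_eq_mul]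
      simp only [hrows, mul_sub, Finset.sum_sub_distrib] at h
      -- h : u < ∑ i, y i * (R / tr Y * tr(A i Y)) - ∑ i, y i * r i
      have hscale : ∑ i, y i * (R / Y.trace * (A i * Y).trace) =
          (R / Y.trace) * ∑ i, y i * (A i * Y).trace := by
        rw [Finset.mul_sum]
        exact Finset.sum_congr rfl fun i _ => by ring
      rw [hscale] at h
      -- multiply through by `tr Y / R > 0`
      have hk : 0 < Y.trace / R := div_pos htrpos hR
      have : (Y.trace / R) * (u + ∑ i, y i * r i) < (Y.trace / R) * ((R / Y.trace) * ∑ i, y i * (A i * Y).trace) :=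
        mul_lt_mul_of_pos_left (by linarith) hk
      rw [← mul_assoc, show Y.trace / R * (R / Y.trace) = 1 by field_simp, one_mul] at this
      have heq : -(u + ∑ i, y i * r i) / R * Y.trace = -((Y.trace / R) * (u + ∑ i, y i * r i)) := by
        field_simp
      rw [heq]
      linarith
  · rw [div_mul_cancel₀ _ hR.ne']
    linarith

/-! ### Trace bounds are free on a finite input type -/

/-- **WLOG the PSD variable is trace-bounded.** For a CONV programme on a finite input type there is
`R > 0` (one plus the sum over all inputs of the trace of a chosen witness) such that, on every input,
feasibility is equivalent to feasibility with the extra row `tr Y ≤ R`. [folklore] -/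
theorem conv_exists_traceBound {ι : Type*} [Fintype ι] {p q : ℕ}
    (A : Fin p → Matrix (Fin q) (Fin q) ℝ) (rhs : (ι → Bool) → Fin p → ℝ) :
    ∃ R : ℝ, 0 < R ∧ ∀ x : ι → Bool,
      (∃ Y : Matrix (Fin q) (Fin q) ℝ, Y.PosSemidef ∧ ∀ i, (A i * Y).trace ≤ rhs x i) ↔
      (∃ Y : Matrix (Fin q) (Fin q) ℝ, Y.PosSemidef ∧ Y.trace ≤ R ∧
        ∀ i, (A i * Y).trace ≤ rhs x i) := by
  classical
  have hT : ∀ x : ι → Bool, ∃ t : ℝ, 0 ≤ t ∧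
      ((∃ Y : Matrix (Fin q) (Fin q) ℝ, Y.PosSemidef ∧ ∀ i, (A i * Y).trace ≤ rhs x i) →
        ∃ Y : Matrix (Fin q) (Fin q) ℝ, Y.PosSemidef ∧ Y.trace ≤ t ∧
          ∀ i, (A i * Y).trace ≤ rhs x i) := by
    intro x
    by_cases h : ∃ Y : Matrix (Fin q) (Fin q) ℝ, Y.PosSemidef ∧ ∀ i, (A i * Y).trace ≤ rhs x i
    · obtain ⟨Y, hY, hrows⟩ := h
      exact ⟨Y.trace, hY.trace_nonneg, fun _ => ⟨Y, hY, le_rfl, hrows⟩⟩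
    · exact ⟨0, le_rfl, fun h' => absurd h' h⟩
  choose T hT0 hTw using hT
  refine ⟨1 + ∑ x, T x, by linarith [Finset.sum_nonneg fun x (_ : x ∈ Finset.univ) => hT0 x],
    fun x => ⟨fun hx => ?_, fun ⟨Y, hY, _, hrows⟩ => ⟨Y, hY, hrows⟩⟩⟩
  obtain ⟨Y, hY, htr, hrows⟩ := hTw x hx
  refine ⟨Y, hY, htr.trans ?_, hrows⟩
  have : T x ≤ ∑ x, T x := Finset.single_le_sum (fun x _ => hT0 x) (Finset.mem_univ x)
  linarith

end Summit.PneNP.PneNP.Theorems
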